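import Summits.AtomisticToContinuum.Crystallization.Theorems.FreeSplittingCertificatesApproxFiniteRangeSplittingP2F

/-!
# FreeSplittingCertificates · ApproxFiniteRangeSplitting — part Holds (§10–§11: the target BY NAME, docking)

Part of the split landing of lens-1 g38 v3 `FreeSplittingCertificatesApproxFiniteRangeSplitting.lean` (sha256 6ca014fa…, 1642 l; module docstring of
record in part 1 `…ApproxFiniteRangeSplitting` / the lens file).  Declarations byte-identical; split for the 400-line rule by prover hand 1, gen 12
(decomp-a2c), --supports stmt-AtomisticToContinuum-12562 (the last part `…Holds` closes it).
-/

namespace Summit.AtomisticToContinuum.Crystallization.Theorems.FreeSplittingCertificatesApproxFiniteRangeSplitting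

/-! ## §10 THE TARGET BY NAME, UNCONDITIONALLY (g38 v2 addendum; 0 sorry) -/

/-- **stmt-AtomisticToContinuum-12562 `FreeSplittingCertificates.ApproxFiniteRangeSplitting` (crux r5)
— PROVED**: P2 (§9) fed to the v1 kernel (§6). Explicitly, radius `R(δ,ε) = (125/2)·δ⁻⁵/ε + 1` and
the Haar-averaged block rule of side `R/√3` built from the `FreePairSplitting` certificates work. -/
theorem approxFiniteRangeSplitting_holds :
    Summit.AtomisticToContinuum.Crystallization.Theses.FreeSplittingCertificates.ApproxFiniteRangeSplitting :=
  approxFiniteRangeSplitting_of_blockAveraging P2.blockAveragedRule_holds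

/-- The `k = 1` rung of the rate ladder holds outright (`C(δ) = (125/2)·δ⁻⁵`). -/
theorem rateRung_one_holds : RateRung 1 :=
  rateRung_one_of_blockAveraging P2.blockAveragedRule_holds

/-- The bottom clause of the route's `Ladder` (stmt-12570), `FiniteRangeSplitting → ApproxFiniteRangeSplitting`,
now holds with an unused hypothesis. -/
theorem ladder_bottom_holds :
    Summit.AtomisticToContinuum.Crystallization.Theses.FreeSplittingCertificates.FiniteRangeSplitting →
      Summit.AtomisticToContinuum.Crystallization.Theses.FreeSplittingCertificates.ApproxFiniteRangeSplitting :=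
  fun _ => approxFiniteRangeSplitting_holds


/-- **Explicit radius for the `ε`-floor** (the quantitative content of §10 in one line): for every hard
core `δ > 0` and tolerance `ε > 0`, some boxed complementary rule of radius `(125/2)·δ⁻⁵/ε + 1` has floor
`e_∞ − ε` on all finite `δ`-separated configurations. -/
theorem ruleFloor_explicit_radius {δ ε : ℝ} (hδ : 0 < δ) (hε : 0 < ε) :
    RuleFloor δ ((125 / 2) * δ⁻¹ ^ 5 / ε + 1) (eInf - ε) := by
  have h3pos : 0 < Real.sqrt 3 := Real.sqrt_pos.2 (by norm_num)
  set R : ℝ := (125 / 2) * δ⁻¹ ^ 5 / ε + 1 with hRdef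
  have hKpos : 0 < (125 / 2) * δ⁻¹ ^ 5 := by positivity
  have hRpos : 0 < R := by positivity
  have hL : 0 < R / Real.sqrt 3 := div_pos hRpos h3pos
  have h := ruleFloor_of_blockAveraging P2.blockAveragedRule_holds hδ hL
  have hrad : Real.sqrt 3 * (R / Real.sqrt 3) = R := by field_simp
  have hsq : Real.sqrt 3 * Real.sqrt 3 = 3 := Real.mul_self_sqrt (by norm_num)
  have hfloor : (125 * Real.sqrt 3 / 6) * δ⁻¹ ^ 5 / (R / Real.sqrt 3) = (125 / 2) * δ⁻¹ ^ 5 / R := by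
    field_simp
    nlinarith [hsq]
  rw [hrad, hfloor] at h
  refine ruleFloor_antitone ?_ h
  -- `e_∞ - ε ≤ e_∞ - K/R` iff `K/R ≤ ε`, and `K/R = K/(K/ε + 1) ≤ ε`.
  have hKR : (125 / 2) * δ⁻¹ ^ 5 / R ≤ ε := by
    rw [div_le_iff₀ hRpos, hRdef]
    have : ε * ((125 / 2) * δ⁻¹ ^ 5 / ε + 1) = (125 / 2) * δ⁻¹ ^ 5 + ε := by field_simp
    rw [this]
    linarith
  linarith

/-! ## §11 DOCKING into the tree's radius-ladder vocabulary (g38 v3 addendum)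

The tree already holds the b2b-freesplit lane's radius ladder for this route
(`Theorems/FreeSplittingCertificatesStrictSplittingRuleDefs.lean`, namespace
`…Theorems.StrictSplittingRuleBirth`: `eInf`, `IsRule`, `Sep`, `siteE`, `Feasible`; and on top of it
`…RadiusLadder.lean` (`RungAt δ R`), `…RadiusLadderApprox.lean` (`AFeasible`, `ARungAt δ ε R`,
`approxFiniteRangeSplitting_iff_arung`), `…RadiusLadderRadiusFloorApprox.lean` (necessary radius floor
`ARungAt δ ε R → δ_½(ε) ≤ max δ R`), `…RadiusLadderScaling.lean` (`ApproxFiniteRangeSplitting ↔ critSepA = 0`)).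
This node's §1 vocabulary is that vocabulary up to names — the identifications below are `Iff.rfl`/`rfl`
(only the light `…StrictSplittingRuleDefs` is imported; the heavier `…RadiusLadder*` chain is not, to keep
the node's import closure small).  Consequently, once this node is landed, a ten-line tree file importing it
together with `…RadiusLadderScaling` obtains `StrictSplittingRuleBirth.critSepA = 0` (the lane's "ONE number"
`δ_A` VANISHES) from `approxFiniteRangeSplitting_holds` and `approxFiniteRangeSplitting_iff_critSepA_eq_zero`,
and `ARungAt δ ε ((125/2)·δ⁻⁵/ε + 1)` for all `δ, ε > 0` from `arung_explicit_radius` below — the SUFFICIENT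
radius complementing the lane's NECESSARY floor `R ≥ δ_½(ε)`. -/
/-- Auxiliary (lens-1 g38 `ApproxFiniteRangeSplitting` ladder). [folklore] -/

theorem eInf_eq_birth :
    eInf = _root_.Summit.AtomisticToContinuum.Crystallization.Theorems.StrictSplittingRuleBirth.eInf := rfl
/-- Auxiliary (lens-1 g38 `ApproxFiniteRangeSplitting` ladder). [folklore] -/

theorem ruleBox_iff_isRule (Φ : EuclideanSpace ℝ (Fin 3) → Finset (EuclideanSpace ℝ (Fin 3)) → ℝ) :
    RuleBox Φ ↔ _root_.Summit.AtomisticToContinuum.Crystallization.Theorems.StrictSplittingRuleBirth.IsRule Φ :=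
  Iff.rfl
/-- Auxiliary (lens-1 g38 `ApproxFiniteRangeSplitting` ladder). [folklore] -/

theorem separated_iff_sep {N : ℕ} (δ : ℝ) (x : Fin N → EuclideanSpace ℝ (Fin 3)) :
    Separated δ x ↔ _root_.Summit.AtomisticToContinuum.Crystallization.Theorems.StrictSplittingRuleBirth.Sep δ x :=
  Iff.rfl
/-- Auxiliary (lens-1 g38 `ApproxFiniteRangeSplitting` ladder). [folklore] -/

theorem weightedSiteEnergy_eq_siteE {N : ℕ} (x : Fin N → EuclideanSpace ℝ (Fin 3)) (R : ℝ)
    (Φ : EuclideanSpace ℝ (Fin 3) → Finset (EuclideanSpace ℝ (Fin 3)) → ℝ) (i : Fin N) :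
    weightedSiteEnergy x R Φ i =
      _root_.Summit.AtomisticToContinuum.Crystallization.Theorems.StrictSplittingRuleBirth.siteE R Φ x i :=
  rfl

/-- `RuleFloor δ R e_∞` is the lane's rung `RungAt δ R` and `RuleFloor δ R (e_∞ - ε)` its `ε`-rung
`ARungAt δ ε R`, literally (both sides unfold to the displayed right-hand side). -/
theorem ruleFloor_iff_birth (δ R f : ℝ) :
    RuleFloor δ R f ↔
      ∃ Φ : EuclideanSpace ℝ (Fin 3) → Finset (EuclideanSpace ℝ (Fin 3)) → ℝ,
        _root_.Summit.AtomisticToContinuum.Crystallization.Theorems.StrictSplittingRuleBirth.IsRule Φ ∧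
          ∀ (N : ℕ) (x : Fin N → EuclideanSpace ℝ (Fin 3)),
            _root_.Summit.AtomisticToContinuum.Crystallization.Theorems.StrictSplittingRuleBirth.Sep δ x →
              ∀ i : Fin N,
                f ≤ _root_.Summit.AtomisticToContinuum.Crystallization.Theorems.StrictSplittingRuleBirth.siteE
                  R Φ x i :=
  Iff.rfl

/-- **The `ε`-rung at explicit radius, in the lane's vocabulary** (= `ARungAt δ ε ((125/2)·δ⁻⁵/ε + 1)` of
`…RadiusLadderApprox`, unfolded). -/
theorem arung_explicit_radius {δ ε : ℝ} (hδ : 0 < δ) (hε : 0 < ε) :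
    ∃ Φ : EuclideanSpace ℝ (Fin 3) → Finset (EuclideanSpace ℝ (Fin 3)) → ℝ,
      _root_.Summit.AtomisticToContinuum.Crystallization.Theorems.StrictSplittingRuleBirth.IsRule Φ ∧
        ∀ (N : ℕ) (x : Fin N → EuclideanSpace ℝ (Fin 3)),
          _root_.Summit.AtomisticToContinuum.Crystallization.Theorems.StrictSplittingRuleBirth.Sep δ x →
            ∀ i : Fin N,
              _root_.Summit.AtomisticToContinuum.Crystallization.Theorems.StrictSplittingRuleBirth.eInf - ε ≤
                _root_.Summit.AtomisticToContinuum.Crystallization.Theorems.StrictSplittingRuleBirth.siteE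
                  ((125 / 2) * δ⁻¹ ^ 5 / ε + 1) Φ x i :=
  (ruleFloor_iff_birth _ _ _).1 (ruleFloor_explicit_radius hδ hε)

end Summit.AtomisticToContinuum.Crystallization.Theorems.FreeSplittingCertificatesApproxFiniteRangeSplitting
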